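import Summits.KontsevichZagierPeriods.KontsevichZagierPeriods.Theorems.LiftingCriteriaCubeNashNormalFormTame
import Literature.NumberTheory.Transcendental.SemialgebraicMaps
import Literature.RingTheory.MvPowerSeries.CoordinateDivision
import Mathlib.RingTheory.Polynomial.Resultant.Basic
import Mathlib.Analysis.Analytic.Basic
import Mathlib.Analysis.Analytic.Uniqueness
import Mathlib.Analysis.Calculus.FDeriv.Analytic
import Mathlib.Analysis.Convex.PathConnected
import Mathlib.Analysis.Normed.Module.Convex
import Mathlib.Topology.MetricSpace.Thickening
import Mathlib.MeasureTheory.Measure.Lebesgue.Basic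

/-!
# Crux `CubeNashNormalForm` (stmt-KontsevichZagierPeriods-3574), line `Sketch` — stub `stub_rootDifferenceDivisor`

**Divisors of a normal-crossing monomial.**  If `f · g = (∏ᵢ xᵢ^{aᵢ}) · e` on an open
neighbourhood `U` of the closed cube `[0,1]ᵈ`, with `f, g, e : ℝᵈ → ℂ` real-analytic and `e`
nowhere zero, then `f = (∏ᵢ xᵢ^{bᵢ}) · u` on an open neighbourhood `V ⊆ U` of the cube with
`b ≤ a` and `u` real-analytic and nowhere zero on `V` (Kiyek–Vicente 2004, Rem. V.4.4: "root
differences divide the discriminant").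

## Proof

Induction on `|a| = ∑ aᵢ`.  If `a = 0` then `f g = e` has no zeros, so `f` has none: `b = 0`,
`u = f`.  Otherwise pick `i` with `aᵢ > 0` and shrink `U` to a *collar* `B` of the cube (a metric
thickening: open, convex, and stable under `x ↦ (x with xᵢ := 0)`, `exists_collar`).  On the
hyperplane piece `B ∩ {xᵢ = 0}` the product `f g` vanishes; composing with the projection onto the
hyperplane and using the identity principle on the connected set `B`
(`AnalyticOnNhd.eqOn_zero_of_preconnected_of_eventuallyEq_zero`), one of `f`, `g` vanishes on the
whole hyperplane piece (`vanish_or_vanish`).  That factor is `xᵢ` times an analytic function on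
`B` (division by a coordinate, `Literature.RingTheory.MvPowerSeries.exists_analyticOnNhd_eq_ofReal_coord_mul`,
proved through convergent power series), and cancelling `xᵢ` (off the hyperplane, then everywhere
by continuity, `eqOn_of_eq_off_coord`) leaves a factorisation with exponent `a - eᵢ`, to which
the induction hypothesis applies.
-/

noncomputable section

open Set MeasureTheory Filter
open scoped Topology
open Literature.ModelTheory.ExponentialFields (IsSemialgebraic)
open Literature.NumberTheory.Transcendental
open Literature.NumberTheory.Transcendental.KZ
open Literature.RingTheory.MvPowerSeries (exists_analyticOnNhd_eq_ofReal_coord_mul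
  eq_of_eventually_eq_off_coord)

namespace Summit.KontsevichZagierPeriods.SymplecticScissors.CubeNashNormalFormRootDifferenceDivisor

/-- **Collars of the cube.** Inside any open `U ⊇ [0,1]ᵈ` there is an open, preconnected set
`B ⊇ [0,1]ᵈ` which is stable under killing any coordinate (a metric thickening of the cube: it is
convex, and `x ↦ (x with xᵢ := 0)` is `1`-Lipschitz for the sup distance and maps the cube into
itself). -/
theorem exists_collar {d : ℕ} {U : Set (Fin d → ℝ)} (hU : IsOpen U)
    (hcU : Set.pi Set.univ (fun _ : Fin d => Set.Icc (0:ℝ) 1) ⊆ U) :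
    ∃ B : Set (Fin d → ℝ), IsOpen B ∧ IsPreconnected B ∧
      Set.pi Set.univ (fun _ : Fin d => Set.Icc (0:ℝ) 1) ⊆ B ∧ B ⊆ U ∧
      ∀ i, ∀ x ∈ B, Function.update x i 0 ∈ B := by
  have hK : IsCompact (Set.pi Set.univ (fun _ : Fin d => Set.Icc (0:ℝ) 1)) :=
    isCompact_univ_pi fun _ => isCompact_Icc
  obtain ⟨δ, hδ, hδU⟩ := hK.exists_thickening_subset_open hU hcU
  refine ⟨Metric.thickening δ (Set.pi Set.univ (fun _ : Fin d => Set.Icc (0:ℝ) 1)),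
    Metric.isOpen_thickening, ((convex_pi fun _ _ => convex_Icc 0 1).thickening δ).isPreconnected,
    Metric.self_subset_thickening hδ _, hδU, fun i x hx => ?_⟩
  rw [Metric.mem_thickening_iff] at hx ⊢
  obtain ⟨z, hz, hxz⟩ := hx
  refine ⟨Function.update z i 0, fun j _ => ?_, lt_of_le_of_lt ?_ hxz⟩
  · by_cases hji : j = i
    · subst hji
      rw [Function.update_self]
      exact ⟨le_rfl, zero_le_one⟩
    · rw [Function.update_of_ne hji]
      exact hz j (Set.mem_univ _)
  · refine (dist_pi_le_iff dist_nonneg).2 fun j => ?_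
    by_cases hji : j = i
    · subst hji
      rw [Function.update_self, Function.update_self, dist_self]
      exact dist_nonneg
    · rw [Function.update_of_ne hji, Function.update_of_ne hji]
      exact dist_le_pi_dist x z j

/-- **One factor vanishes on the hyperplane.** On a preconnected open `B` stable under
`πᵢ : x ↦ (x with xᵢ := 0)`, if `f g = 0` on `B ∩ {xᵢ = 0}` for `f, g` real-analytic on `B`, then
`f` or `g` vanishes identically on `B ∩ {xᵢ = 0}`: `(f ∘ πᵢ)(g ∘ πᵢ) = 0` on `B`, and if `f ∘ πᵢ` is
not identically zero then `g ∘ πᵢ` vanishes on a non-empty open subset of `B`, hence on `B` by the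
identity principle. -/
theorem vanish_or_vanish {d : ℕ} {B : Set (Fin d → ℝ)} (hBo : IsOpen B) (hBc : IsPreconnected B)
    {i : Fin d} (hBi : ∀ x ∈ B, Function.update x i 0 ∈ B) {f g : (Fin d → ℝ) → ℂ}
    (hf : AnalyticOnNhd ℝ f B) (hg : AnalyticOnNhd ℝ g B)
    (hfg : ∀ x ∈ B, x i = 0 → f x * g x = 0) :
    (∀ x ∈ B, x i = 0 → f x = 0) ∨ (∀ x ∈ B, x i = 0 → g x = 0) := by
  have hπ : ∀ x : Fin d → ℝ, AnalyticAt ℝ (fun x : Fin d → ℝ => Function.update x i (0:ℝ)) x := by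
    intro x
    refine analyticAt_pi_iff.2 fun j => ?_
    by_cases hji : j = i
    · subst hji
      simp only [Function.update_self]
      exact analyticAt_const
    · simp only [Function.update_of_ne hji]
      exact (ContinuousLinearMap.proj (R := ℝ) (φ := fun _ : Fin d => ℝ) j).analyticAt x
  have hupd : ∀ x : Fin d → ℝ, x i = 0 → Function.update x i 0 = x := fun x hxi => by
    rw [← hxi, Function.update_eq_self]
  have hF : AnalyticOnNhd ℝ (fun x => f (Function.update x i 0)) B := fun x hx =>
    AnalyticAt.comp (g := f) (f := fun x : Fin d → ℝ => Function.update x i (0:ℝ))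
      (hf _ (hBi x hx)) (hπ x)
  have hG : AnalyticOnNhd ℝ (fun x => g (Function.update x i 0)) B := fun x hx =>
    AnalyticAt.comp (g := g) (f := fun x : Fin d → ℝ => Function.update x i (0:ℝ))
      (hg _ (hBi x hx)) (hπ x)
  by_cases hF0 : ∀ x ∈ B, f (Function.update x i 0) = 0
  · left
    intro x hx hxi
    rw [← hupd x hxi]
    exact hF0 x hx
  · right
    push Not at hF0
    obtain ⟨x₀, hx₀, hFx₀⟩ := hF0
    have hGev : (fun x => g (Function.update x i 0)) =ᶠ[𝓝 x₀] 0 := by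
      have h1 : ∀ᶠ x in 𝓝 x₀, f (Function.update x i 0) ≠ 0 :=
        (hF x₀ hx₀).continuousAt.eventually_ne hFx₀
      have h2 : ∀ᶠ x in 𝓝 x₀, x ∈ B := hBo.mem_nhds hx₀
      filter_upwards [h1, h2] with x h1 h2
      exact (mul_eq_zero.1 (hfg _ (hBi x h2) (by simp))).resolve_left h1
    have hG0 := hG.eqOn_zero_of_preconnected_of_eventuallyEq_zero hBc hx₀ hGev
    intro x hx hxi
    have h1 := hG0 hx
    simp only [Pi.zero_apply] at h1
    rwa [hupd x hxi] at h1

/-- **Cancellation across the hyperplane.** Continuous functions on an open set which agree off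
`{xᵢ = 0}` agree everywhere (`Literature.RingTheory.MvPowerSeries.eq_of_eventually_eq_off_coord`). -/
theorem eqOn_of_eq_off_coord {d : ℕ} {B : Set (Fin d → ℝ)} (hBo : IsOpen B) (i : Fin d)
    {φ ψ : (Fin d → ℝ) → ℂ} (hφ : ContinuousOn φ B) (hψ : ContinuousOn ψ B)
    (h : ∀ x ∈ B, x i ≠ 0 → φ x = ψ x) : ∀ x ∈ B, φ x = ψ x := fun _ hx =>
  eq_of_eventually_eq_off_coord i (hφ.continuousAt (hBo.mem_nhds hx))
    (hψ.continuousAt (hBo.mem_nhds hx))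
    (Filter.mem_of_superset (hBo.mem_nhds hx) fun y hy hyi => h y hy hyi)

/-- Splitting one factor `xᵢ` off a monomial: if `c = c' + eᵢ` then `x^c = xᵢ · x^{c'}`. -/
theorem prod_pow_eq_mul_prod_pow {d : ℕ} {i : Fin d} {c c' : Fin d → ℕ} (hi : c i = c' i + 1)
    (hj : ∀ j, j ≠ i → c j = c' j) (x : Fin d → ℂ) :
    (∏ j, x j ^ c j) = x i * ∏ j, x j ^ c' j := by
  rw [← Finset.mul_prod_erase Finset.univ (fun j => x j ^ c j) (Finset.mem_univ i),
    ← Finset.mul_prod_erase Finset.univ (fun j => x j ^ c' j) (Finset.mem_univ i), hi, pow_succ,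
    Finset.prod_congr rfl fun j hj' => by rw [hj j (Finset.ne_of_mem_erase hj')]]
  ring

/-- The monomial functions `x ↦ ∏ⱼ xⱼ^{cⱼ}` (`ℂ`-valued) are continuous. -/
theorem continuous_prod_pow {d : ℕ} (c : Fin d → ℕ) :
    Continuous fun x : Fin d → ℝ => ∏ j, ((x j : ℝ) : ℂ) ^ c j :=
  continuous_finsetProd _ fun j _ => (Complex.continuous_ofReal.comp (continuous_apply j)).pow _

/-- **The divisor lemma, by induction on the total degree `|a| = n` of the monomial.** -/
theorem divisor_aux (d n : ℕ) : ∀ (a : Fin d → ℕ), (∑ i, a i) = n →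
    ∀ (U : Set (Fin d → ℝ)), IsOpen U → Set.pi Set.univ (fun _ : Fin d => Set.Icc (0:ℝ) 1) ⊆ U →
    ∀ (f g e : (Fin d → ℝ) → ℂ), AnalyticOnNhd ℝ f U → AnalyticOnNhd ℝ g U →
    AnalyticOnNhd ℝ e U → (∀ x ∈ U, e x ≠ 0) →
    (∀ x ∈ U, f x * g x = (∏ i, ((x i : ℝ) : ℂ) ^ a i) * e x) →
    ∃ (b : Fin d → ℕ) (V : Set (Fin d → ℝ)) (u : (Fin d → ℝ) → ℂ), IsOpen V ∧
      Set.pi Set.univ (fun _ : Fin d => Set.Icc (0:ℝ) 1) ⊆ V ∧ V ⊆ U ∧ AnalyticOnNhd ℝ u V ∧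
      (∀ x ∈ V, u x ≠ 0) ∧ (∀ i, b i ≤ a i) ∧
      ∀ x ∈ V, f x = (∏ i, ((x i : ℝ) : ℂ) ^ b i) * u x := by
  induction n with
  | zero =>
    intro a ha U hU hcU f g e hf hg he he0 hfg
    have ha0 : ∀ i, a i = 0 := fun i => (Finset.sum_eq_zero_iff.1 ha) i (Finset.mem_univ i)
    refine ⟨fun _ => 0, U, f, hU, hcU, subset_rfl, hf, fun x hx hfx => ?_, fun i => Nat.zero_le _,
      fun x _ => by simp⟩
    apply he0 x hx
    have h1 := hfg x hx
    simp only [ha0, pow_zero, Finset.prod_const_one, one_mul, hfx, zero_mul] at h1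
    exact h1.symm
  | succ n ih =>
    intro a ha U hU hcU f g e hf hg he he0 hfg
    obtain ⟨i, hi⟩ : ∃ i, a i ≠ 0 := by
      by_contra hcon
      push Not at hcon
      rw [Finset.sum_eq_zero fun i _ => hcon i] at ha
      exact Nat.succ_ne_zero n ha.symm
    obtain ⟨B, hBo, hBc, hcB, hBU, hBst⟩ := exists_collar hU hcU
    have hfB : AnalyticOnNhd ℝ f B := hf.mono hBU
    have hgB : AnalyticOnNhd ℝ g B := hg.mono hBU
    have heB : AnalyticOnNhd ℝ e B := he.mono hBU
    have he0B : ∀ x ∈ B, e x ≠ 0 := fun x hx => he0 x (hBU hx)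
    -- the reduced exponent `a' = a - eᵢ`
    set a' : Fin d → ℕ := Function.update a i (a i - 1) with ha'def
    have ha'i : a i = a' i + 1 := by
      rw [ha'def, Function.update_self]
      omega
    have ha'j : ∀ j, j ≠ i → a j = a' j := fun j hj => by rw [ha'def, Function.update_of_ne hj]
    have ha'le : ∀ j, a' j ≤ a j := fun j => by
      by_cases hji : j = i
      · subst hji; omega
      · rw [ha'j j hji]
    have ha' : ∑ j, a' j = n := by
      have h1 := Finset.sum_update_of_mem (Finset.mem_univ i) a (a i - 1)
      have h2 := Finset.add_sum_erase Finset.univ a (Finset.mem_univ i)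
      rw [← ha'def, Finset.sdiff_singleton_eq_erase] at h1
      omega
    have hPa : ∀ x : Fin d → ℝ,
        (∏ j, ((x j : ℝ) : ℂ) ^ a j) = (x i : ℂ) * ∏ j, ((x j : ℝ) : ℂ) ^ a' j :=
      fun x => prod_pow_eq_mul_prod_pow ha'i ha'j fun j => ((x j : ℝ) : ℂ)
    -- `f g` vanishes on the hyperplane piece of `B`
    have hfg0 : ∀ x ∈ B, x i = 0 → f x * g x = 0 := fun x hx hxi => by
      rw [hfg x (hBU hx), hPa, hxi, Complex.ofReal_zero, zero_mul, zero_mul]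
    rcases vanish_or_vanish hBo hBc (hBst i) hfB hgB hfg0 with hf0 | hg0
    · -- `f = xᵢ f'`
      obtain ⟨f', hf', hff'⟩ := exists_analyticOnNhd_eq_ofReal_coord_mul hBo hfB i hf0
      have key : ∀ x ∈ B, f' x * g x = (∏ j, ((x j : ℝ) : ℂ) ^ a' j) * e x := by
        refine eqOn_of_eq_off_coord hBo i (hf'.continuousOn.mul hgB.continuousOn)
          ((continuous_prod_pow a').continuousOn.mul heB.continuousOn) fun x hx hxi => ?_
        have h1 := hfg x (hBU hx)
        rw [hff' x hx, hPa x, mul_assoc, mul_assoc] at h1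
        exact mul_left_cancel₀ (Complex.ofReal_ne_zero.2 hxi) h1
      obtain ⟨b', V, u, hVo, hcV, hVB, hu, hu0, hb', hfV⟩ :=
        ih a' ha' B hBo hcB f' g e hf' hgB heB he0B key
      refine ⟨Function.update b' i (b' i + 1), V, u, hVo, hcV, hVB.trans hBU, hu, hu0,
        fun j => ?_, fun x hx => ?_⟩
      · by_cases hji : j = i
        · subst hji
          rw [Function.update_self]
          have := hb' j
          omega
        · rw [Function.update_of_ne hji, ha'j j hji]
          exact hb' j
      · rw [hff' x (hVB hx), hfV x hx, ← mul_assoc,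
          prod_pow_eq_mul_prod_pow (c := Function.update b' i (b' i + 1)) (c' := b')
            (Function.update_self _ _ _) (fun j hj => Function.update_of_ne hj _ _)
            fun j => ((x j : ℝ) : ℂ)]
    · -- `g = xᵢ g'`
      obtain ⟨g', hg', hgg'⟩ := exists_analyticOnNhd_eq_ofReal_coord_mul hBo hgB i hg0
      have key : ∀ x ∈ B, f x * g' x = (∏ j, ((x j : ℝ) : ℂ) ^ a' j) * e x := by
        refine eqOn_of_eq_off_coord hBo i (hfB.continuousOn.mul hg'.continuousOn)
          ((continuous_prod_pow a').continuousOn.mul heB.continuousOn) fun x hx hxi => ?_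
        have h1 := hfg x (hBU hx)
        rw [hgg' x hx, hPa x, mul_left_comm, mul_assoc] at h1
        exact mul_left_cancel₀ (Complex.ofReal_ne_zero.2 hxi) h1
      obtain ⟨b, V, u, hVo, hcV, hVB, hu, hu0, hb, hfV⟩ :=
        ih a' ha' B hBo hcB f g' e hfB hg' heB he0B key
      exact ⟨b, V, u, hVo, hcV, hVB.trans hBU, hu, hu0, fun j => (hb j).trans (ha'le j), hfV⟩

/-- **Stub S7 `stub_rootDifferenceDivisor` (divisors of a normal-crossing monomial, M–L).** If
`f · g = (∏ xᵢ^{aᵢ}) · e` on an open `U ⊇ [0,1]ᵈ` with `f, g, e : ℝᵈ → ℂ` real-analytic and `e`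
nowhere zero, then `f = (∏ xᵢ^{bᵢ}) · u` near the closed cube with `b ≤ a` and `u` analytic, nowhere
zero: at each point `p` of the cube expand in convergent power series (tree:
`MvPowerSeries/OfAnalytic`, `EvalAnalytic`); the Newton polyhedra of the two factors add up to the
orthant `a(p) + ℝ₊ᵈ`, hence each is a translated orthant, i.e. each factor is a monomial times a unit of
`ℂ{x − p}`; the exponent along the face `xᵢ = 0` is locally constant, the quotient glues.
[Kiyek–Vicente 2004, Rem. V.4.4; Grauert–Remmert 1971, Kap. I §3] -/
theorem stub_rootDifferenceDivisor : ∀ d : ℕ, (∀ (U : Set (Fin d → ℝ)), IsOpen U → Set.pi Set.univ (fun _ : Fin d => Set.Icc (0:ℝ) 1) ⊆ U → ∀ (f g e : (Fin d → ℝ) → ℂ) (a : Fin d → ℕ), AnalyticOnNhd ℝ f U → AnalyticOnNhd ℝ g U → AnalyticOnNhd ℝ e U → (∀ x ∈ U, e x ≠ 0) → (∀ x ∈ U, f x * g x = (∏ i, ((x i : ℝ) : ℂ) ^ a i) * e x) → ∃ (b : Fin d → ℕ) (V : Set (Fin d → ℝ)) (u : (Fin d → ℝ) → ℂ), IsOpen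 V ∧ Set.pi Set.univ (fun _ : Fin d => Set.Icc (0:ℝ) 1) ⊆ V ∧ V ⊆ U ∧ AnalyticOnNhd ℝ u V ∧ (∀ x ∈ V, u x ≠ 0) ∧ (∀ i, b i ≤ a i) ∧ ∀ x ∈ V, f x = (∏ i, ((x i : ℝ) : ℂ) ^ b i) * u x) := by
  intro d U hU hcU f g e a hf hg he he0 hfg
  exact divisor_aux d _ a rfl U hU hcU f g e hf hg he he0 hfg

end Summit.KontsevichZagierPeriods.SymplecticScissors.CubeNashNormalFormRootDifferenceDivisor

end
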